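import Mathlib.Analysis.SpecialFunctions.Gaussian.GaussianIntegral
import Literature.NumberTheory.LFunctions.VonKochConverse
import Literature.NumberTheory.LFunctions.LaplaceSeriesAbelian
import HarnessLib

/-!
# The Laplace series `∑ Λ(n) e^{-nt}`: Mellin transform and a Landau-type converse

Support file for the converse direction of Granville's theorem
`RH ↔ ∑_{N ≤ x, N even} (G(N) − J(N)) ≪ x^{3/2+o(1)}` (`Literature.NumberTheory.Sieve.granville_thm1A`;
A. Granville, Funct. Approx. Comment. Math. 37 (2007), Thm. 1A, completed by G. Bhowmik,
I. Z. Ruzsa, Anal. Math. 44 (2018), Thm. 2.1). Everything here is proved.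

* `mellin_laplaceSeries`: for a real sequence `b` with `b₀ = 0`, `|bₙ| ≤ n + 1` and
  `∑ |bₙ| n^{-σ} < ∞`, the Mellin transform of `t ↦ ∑ bₙ e^{-nt}` at `s` (`Re s = σ > 0`) is
  `Γ(s) · L(b, s)` (termwise Euler integral `∫₀^∞ t^{s-1} e^{-nt} dt = Γ(s) n^{-s}`, Mathlib
  `Complex.integral_cpow_mul_exp_neg_mul_Ioi`, summed under the integral sign).
* `quasiRiemannHypothesis_of_laplaceSeries_vonMangoldt_isBigO` (**Landau-type converse for the
  Laplace series**): if `∑ Λ(n) e^{-nt} = 1/t + O(t^{-σ₀})` as `t → 0⁺` (`0 < σ₀`), then `ζ(s) ≠ 0`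
  for `σ₀ < Re s < 1` (`Literature.NumberTheory.LFunctions.QuasiRiemannHypothesis σ₀`).
  Proof: with `f(t) = ∑ (Λ(n) − 1) e^{-nt} = ∑ Λ(n)e^{-nt} − 1/(eᵗ − 1)`, the Mellin transform
  `M(s) = ∫₀^∞ f(t) t^{s-1} dt` is holomorphic on `Re s > σ₀` (Mathlib
  `mellin_differentiableAt_of_isBigO_rpow_exp`) and equals `Γ(s)(−ζ'/ζ(s) − ζ(s))` on `Re s > 1`;
  then one argues exactly as in Montgomery–Vaughan §15.1 (the tree's
  `Literature/NumberTheory/LFunctions/VonKochConverse.lean`, whose slit half-plane and local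
  uniqueness lemma are reused): `Φ = ζ'Γ + (M + Γζ)ζ` vanishes on the slit half-plane, and a zero
  of `ζ` in the strip would force `ζ ≡ 0`.
* `quasiRiemannHypothesis_of_selfConvSum_vonMangoldt` (Bhowmik–Ruzsa Thm. 2.1, sharpened to
  `δ' = δ`): if `∑_{m ≤ n} ∑_{i+j=m} Λ(i)Λ(j) = n²/2 + O((n+1)^α)` with `1 < α`, then `ζ(s) ≠ 0`
  for `Re s > α − 1` (Abelian step `Literature.NumberTheory.LFunctions.exists_abs_laplaceSeries_sub_inv_le`
  + the converse above). Bhowmik–Ruzsa obtain `Re ρ < 1 − δ/6` by a Tauberian passage back to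
  `ψ`; the Mellin route avoids the loss, as they note is possible "through an explicit expression
  of `S(x)`" (Remark 1).

## References

* G. Bhowmik, I. Z. Ruzsa, *Average Goldbach and the quasi-Riemann hypothesis*, Anal. Math. 44
  (2018), 51–56, Thm. 2.1 and Remark 1.
* H. L. Montgomery, R. C. Vaughan, *Multiplicative Number Theory I*, CUP 2007, §15.1 (the
  analytic-continuation argument, there for `ψ`).
* A. Granville, Funct. Approx. Comment. Math. 37 (2007), 159–173, Thm. 1A, (5.2).
-/

noncomputable section

open Filter Asymptotics MeasureTheory Set Complex
open scoped Topology ArithmeticFunction.vonMangoldt ArithmeticFunction.zeta LSeries.notation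

namespace Literature.NumberTheory.LFunctions

/-! ### Analytic properties of a Laplace series with `|bₙ| ≤ n + 1` -/

section General

variable {b : ℕ → ℝ}

/-- `|bₙ| ≤ n + 1` in the form `|bₙ| ≤ 1 · (n+1)^1` consumed by `LaplaceSeriesAbelian`. [folklore] -/
theorem abs_le_one_mul_pow_one (hb : ∀ n, |b n| ≤ (n : ℝ) + 1) (n : ℕ) :
    |b n| ≤ 1 * ((n : ℝ) + 1) ^ 1 := by
  rw [one_mul, pow_one]; exact hb n

/-- A Laplace series with `|bₙ| ≤ n + 1` is continuous on `(0, ∞)` (uniform convergence on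
`t > t₀/2`). [folklore] -/
theorem continuousOn_laplaceSeries (hb : ∀ n, |b n| ≤ (n : ℝ) + 1) :
    ContinuousOn (laplaceSeries b) (Ioi 0) := by
  intro t ht
  have ht' : (0 : ℝ) < t := ht
  have ht2 : 0 < t / 2 := by linarith
  have hcont : ContinuousOn (laplaceSeries b) (Ioi (t / 2)) := by
    have hu := summable_pow_succ_mul_exp ht2 1
    rw [show laplaceSeries b = fun x ↦ ∑' n : ℕ, b n * Real.exp (-x * n) from rfl]
    refine continuousOn_tsum (fun n ↦ ?_) hu (fun n x hx ↦ ?_)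
    · exact (by fun_prop : Continuous fun x : ℝ ↦ b n * Real.exp (-x * n)).continuousOn
    · have hx' : t / 2 < x := hx
      rw [norm_mul, Real.norm_eq_abs, Real.norm_eq_abs, abs_of_pos (Real.exp_pos _), pow_one]
      refine mul_le_mul (hb n) (Real.exp_le_exp.mpr ?_) (Real.exp_pos _).le (by positivity)
      nlinarith [(n.cast_nonneg : (0 : ℝ) ≤ n)]
  exact (hcont.continuousAt (Ioi_mem_nhds (by linarith))).continuousWithinAt

/-- Exponential decay: if moreover `b₀ = 0`, then `|∑ bₙ e^{-nt}| ≤ C e^{-t}` for `t ≥ 1`.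
[folklore] -/
theorem exists_abs_laplaceSeries_le_exp_neg (hb0 : b 0 = 0) (hb : ∀ n, |b n| ≤ (n : ℝ) + 1) :
    ∃ C, ∀ t, 1 ≤ t → |laplaceSeries b t| ≤ C * Real.exp (-t) := by
  have hs1 := summable_pow_succ_mul_exp one_pos 1
  refine ⟨Real.exp 1 * ∑' n : ℕ, ((n : ℝ) + 1) ^ 1 * Real.exp (-1 * n), fun t ht ↦ ?_⟩
  have hterm : ∀ n : ℕ, ‖b n * Real.exp (-t * n)‖ ≤
      Real.exp (1 - t) * (((n : ℝ) + 1) ^ 1 * Real.exp (-1 * n)) := by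
    intro n
    rcases eq_or_ne n 0 with rfl | hn
    · simp only [hb0, zero_mul, norm_zero]; positivity
    · rw [norm_mul, Real.norm_eq_abs, Real.norm_eq_abs, abs_of_pos (Real.exp_pos _), pow_one]
      have h1 : (1 : ℝ) ≤ n := by exact_mod_cast Nat.one_le_iff_ne_zero.mpr hn
      calc |b n| * Real.exp (-t * n) ≤ ((n : ℝ) + 1) * Real.exp (-t * n) :=
            mul_le_mul_of_nonneg_right (hb n) (Real.exp_pos _).le
        _ ≤ ((n : ℝ) + 1) * (Real.exp (1 - t) * Real.exp (-1 * n)) := by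
            gcongr
            rw [← Real.exp_add]
            exact Real.exp_le_exp.mpr (by nlinarith)
        _ = Real.exp (1 - t) * (((n : ℝ) + 1) * Real.exp (-1 * n)) := by ring
  have hsum : Summable fun n : ℕ ↦ ‖b n * Real.exp (-t * n)‖ :=
    Summable.of_nonneg_of_le (fun n ↦ norm_nonneg _) hterm (hs1.mul_left _)
  calc |laplaceSeries b t| ≤ ∑' n : ℕ, ‖b n * Real.exp (-t * n)‖ := by
        rw [← Real.norm_eq_abs]; exact norm_tsum_le_tsum_norm hsum
    _ ≤ ∑' n : ℕ, Real.exp (1 - t) * (((n : ℝ) + 1) ^ 1 * Real.exp (-1 * n)) :=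
        hsum.tsum_le_tsum hterm (hs1.mul_left _)
    _ = Real.exp (1 - t) * ∑' n : ℕ, ((n : ℝ) + 1) ^ 1 * Real.exp (-1 * n) := tsum_mul_left
    _ = Real.exp 1 * (∑' n : ℕ, ((n : ℝ) + 1) ^ 1 * Real.exp (-1 * n)) * Real.exp (-t) := by
        rw [sub_eq_add_neg, Real.exp_add]; ring

/-- **Mellin transform of a Laplace series.** For `b₀ = 0`, `|bₙ| ≤ n + 1`, `Re s > 0` and
`∑ |bₙ| n^{-Re s} < ∞`:  `∫₀^∞ (∑ bₙ e^{-nt}) t^{s-1} dt = Γ(s) · ∑ bₙ n^{-s}` (termwise Euler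
integrals, interchanged by absolute convergence). For `b = Λ` this is the classical
`∫₀^∞ (∑ Λ(n)e^{-nt}) t^{s-1} dt = −Γ(s) ζ'(s)/ζ(s)`. [folklore] -/
theorem mellin_laplaceSeries (hb0 : b 0 = 0) {s : ℂ} (hs : 0 < s.re)
    (hsum : Summable fun n : ℕ ↦ |b n| / (n : ℝ) ^ s.re) :
    mellin (fun t ↦ ((laplaceSeries b t : ℝ) : ℂ)) s =
      Complex.Gamma s * LSeries (fun n ↦ (b n : ℂ)) s := by
  set G : ℕ → ℝ → ℂ := fun n t ↦ (t : ℂ) ^ (s - 1) * ((b n * Real.exp (-t * n) : ℝ) : ℂ)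
    with hG
  have hb0' : (fun n ↦ (b n : ℂ)) 0 = 0 := by simp [hb0]
  -- pointwise expansion of the Mellin integrand
  have hpt : ∀ t ∈ Ioi (0 : ℝ),
      (t : ℂ) ^ (s - 1) • ((laplaceSeries b t : ℝ) : ℂ) = ∑' n : ℕ, G n t := by
    intro t _
    rw [laplaceSeries_def, Complex.ofReal_tsum, smul_eq_mul, ← tsum_mul_left]
  -- the norm of each term on `(0, ∞)`
  have hnorm_eq : ∀ n : ℕ, ∀ t ∈ Ioi (0 : ℝ),
      ‖G n t‖ = |b n| * (t ^ (s.re - 1) * Real.exp (-(n * t))) := by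
    intro n t ht
    have ht' : (0 : ℝ) < t := ht
    simp only [hG, norm_mul, Complex.norm_real, Real.norm_eq_abs,
      Complex.norm_cpow_eq_rpow_re_of_pos ht', sub_re, one_re, abs_of_pos (Real.exp_pos _)]
    ring_nf
  -- the value of each termwise integral
  have hval : ∀ n : ℕ, ∫ t in Ioi (0 : ℝ), G n t =
      Complex.Gamma s * LSeries.term (fun n ↦ (b n : ℂ)) s n := by
    intro n
    rcases eq_or_ne n 0 with rfl | hn
    · simp [hG, hb0]
    have hn' : (0 : ℝ) < n := by exact_mod_cast Nat.pos_of_ne_zero hn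
    have key := Complex.integral_cpow_mul_exp_neg_mul_Ioi hs hn'
    have h1 : ∀ t : ℝ, G n t =
        (b n : ℂ) * ((t : ℂ) ^ (s - 1) * Complex.exp (-((n : ℝ) * (t : ℂ)))) := by
      intro t
      simp only [hG]
      push_cast
      ring_nf
    simp_rw [h1]
    rw [integral_const_mul, key, LSeries.term_def₀ hb0' s n]
    have h2 : (1 / ((n : ℝ) : ℂ)) ^ s = (n : ℂ) ^ (-s) := by
      rw [Complex.ofReal_natCast, one_div, Complex.inv_cpow _ _ ?_, Complex.cpow_neg]
      rw [Complex.natCast_arg]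
      exact Real.pi_ne_zero.symm
    rw [h2]
    ring
  -- integrability of each term
  have hint : ∀ n : ℕ, Integrable (G n) (volume.restrict (Ioi 0)) := by
    intro n
    rcases eq_or_ne n 0 with rfl | hn
    · have : G 0 = fun _ ↦ 0 := by funext t; simp [hG, hb0]
      rw [this]
      exact integrable_zero _ _ _
    have hn' : (0 : ℝ) < n := by exact_mod_cast Nat.pos_of_ne_zero hn
    have hg : IntegrableOn (fun t : ℝ ↦ |b n| * (t ^ (s.re - 1) * Real.exp (-(n * t)))) (Ioi 0) := by
      have h := integrableOn_rpow_mul_exp_neg_mul_rpow (s := s.re - 1) (p := 1) (b := n)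
        (by linarith) le_rfl hn'
      refine Integrable.const_mul (h.congr_fun (fun t _ ↦ ?_) measurableSet_Ioi) _
      simp only [Real.rpow_one]
      ring_nf
    have hmeas : AEStronglyMeasurable (G n) (volume.restrict (Ioi 0)) := by
      refine ContinuousOn.aestronglyMeasurable (fun t ht ↦ ?_) measurableSet_Ioi
      have ht' : (0 : ℝ) < t := ht
      refine ContinuousAt.continuousWithinAt (ContinuousAt.mul ?_ ?_)
      · exact continuousAt_ofReal_cpow_const _ _ (Or.inr ht'.ne')
      · exact (Complex.continuous_ofReal.comp (by fun_prop)).continuousAt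
    refine Integrable.mono' hg hmeas ?_
    rw [ae_restrict_iff' measurableSet_Ioi]
    exact ae_of_all _ fun t ht ↦ (hnorm_eq n t ht).le
  -- the integrals of the norms
  have hnorm_val : ∀ n : ℕ, ∫ t in Ioi (0 : ℝ), ‖G n t‖ =
      Real.Gamma s.re * (|b n| / (n : ℝ) ^ s.re) := by
    intro n
    rcases eq_or_ne n 0 with rfl | hn
    · have : ∀ t ∈ Ioi (0 : ℝ), ‖G 0 t‖ = 0 := fun t _ ↦ by simp [hG, hb0]
      rw [setIntegral_congr_fun measurableSet_Ioi this]
      simp [hb0]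
    have hn' : (0 : ℝ) < n := by exact_mod_cast Nat.pos_of_ne_zero hn
    rw [setIntegral_congr_fun measurableSet_Ioi (hnorm_eq n), integral_const_mul,
      Real.integral_rpow_mul_exp_neg_mul_Ioi hs hn', Real.div_rpow zero_le_one hn'.le,
      Real.one_rpow]
    ring
  have hsum' : Summable fun n : ℕ ↦ ∫ t in Ioi (0 : ℝ), ‖G n t‖ := by
    simp_rw [hnorm_val]
    exact hsum.mul_left _
  -- assemble
  calc mellin (fun t ↦ ((laplaceSeries b t : ℝ) : ℂ)) s
      = ∫ t in Ioi (0 : ℝ), ∑' n : ℕ, G n t := setIntegral_congr_fun measurableSet_Ioi hpt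
    _ = ∑' n : ℕ, ∫ t in Ioi (0 : ℝ), G n t :=
        (integral_tsum_of_summable_integral_norm hint hsum').symm
    _ = ∑' n : ℕ, Complex.Gamma s * LSeries.term (fun n ↦ (b n : ℂ)) s n := tsum_congr hval
    _ = Complex.Gamma s * LSeries (fun n ↦ (b n : ℂ)) s := by rw [tsum_mul_left]; rfl

/-- The Mellin transform of a Laplace series with `b₀ = 0`, `|bₙ| ≤ n + 1` which is
`O(t^{-σ₀})` at `0⁺` is holomorphic on `Re s > σ₀`. [folklore] -/
theorem differentiableAt_mellin_laplaceSeries (hb0 : b 0 = 0) (hb : ∀ n, |b n| ≤ (n : ℝ) + 1)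
    {σ₀ : ℝ} (hO : (fun t ↦ ((laplaceSeries b t : ℝ) : ℂ)) =O[𝓝[>] 0] fun t ↦ t ^ (-σ₀))
    {s : ℂ} (hs : σ₀ < s.re) :
    DifferentiableAt ℂ (mellin fun t ↦ ((laplaceSeries b t : ℝ) : ℂ)) s := by
  refine mellin_differentiableAt_of_isBigO_rpow_exp one_pos ?_ ?_ hO hs
  · exact (Complex.continuous_ofReal.comp_continuousOn (continuousOn_laplaceSeries hb))
      |>.locallyIntegrableOn measurableSet_Ioi
  · obtain ⟨C, hC⟩ := exists_abs_laplaceSeries_le_exp_neg hb0 hb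
    refine IsBigO.of_bound C ?_
    filter_upwards [eventually_ge_atTop 1] with t ht
    rw [Complex.norm_real, Real.norm_eq_abs, Real.norm_eq_abs, abs_of_pos (Real.exp_pos _),
      neg_one_mul]
    exact hC t ht

end General

/-! ### The sequence `Λ(n) − 1` -/

/-- `|Λ(n) − 1| ≤ n + 1` (and the value at `0` is `0`): the coefficient bound for
`b = Λ − ζ`. [folklore] -/
theorem abs_vonMangoldt_sub_zeta_le (n : ℕ) : |Λ n - (ζ n : ℝ)| ≤ (n : ℝ) + 1 := by
  rcases eq_or_ne n 0 with rfl | hn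
  · simp
  · rw [ArithmeticFunction.zeta_apply_ne hn, Nat.cast_one]
    have h0 := ArithmeticFunction.vonMangoldt_nonneg (n := n)
    have h1 : Λ n ≤ n := ArithmeticFunction.vonMangoldt_le_log.trans (Real.log_le_self n.cast_nonneg)
    rw [abs_le]
    constructor <;> linarith

/-- `Λ(0) − ζ(0) = 0`. [folklore] -/
theorem vonMangoldt_sub_zeta_zero : Λ 0 - ((ζ 0 : ℕ) : ℝ) = 0 := by simp

/-- `0 ≤ Λ(n) ≤ n + 1`. [folklore] -/
theorem vonMangoldt_nonneg_le (n : ℕ) : 0 ≤ Λ n ∧ Λ n ≤ (n : ℝ) + 1 :=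
  ⟨ArithmeticFunction.vonMangoldt_nonneg,
    (ArithmeticFunction.vonMangoldt_le_log.trans (Real.log_le_self n.cast_nonneg)).trans
      (by linarith)⟩

/-- `|ζ(n)| ≤ n + 1` for the arithmetic function `ζ`. [folklore] -/
theorem abs_zeta_le (n : ℕ) : |((ζ n : ℕ) : ℝ)| ≤ (n : ℝ) + 1 := by
  rcases eq_or_ne n 0 with rfl | hn
  · simp
  · rw [ArithmeticFunction.zeta_apply_ne hn]
    simp only [Nat.cast_one, abs_one]
    linarith [(n.cast_nonneg : (0 : ℝ) ≤ n)]

/-- For `Re s > 1`, `∑ |Λ(n) − ζ(n)| n^{-Re s} < ∞`. [folklore] -/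
theorem summable_abs_vonMangoldt_sub_zeta_div_rpow {s : ℂ} (hs : 1 < s.re) :
    Summable fun n : ℕ ↦ |Λ n - (ζ n : ℝ)| / (n : ℝ) ^ s.re := by
  have hΛ := ArithmeticFunction.LSeriesSummable_vonMangoldt hs
  have hζ := ArithmeticFunction.LSeriesSummable_zeta_iff.mpr hs
  have hsub : LSeriesSummable (↗Λ - ↗ζ) s := by
    have := hΛ.sub hζ
    simpa [LSeriesSummable, LSeries.term_sub] using this
  have hfun : (↗Λ - ↗ζ : ℕ → ℂ) = fun n ↦ ((Λ n - (ζ n : ℝ) : ℝ) : ℂ) := by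
    funext n
    simp only [Pi.sub_apply, Complex.ofReal_sub, Complex.ofReal_natCast]
  rw [LSeriesSummable, ← summable_norm_iff, hfun] at hsub
  refine hsub.congr fun n ↦ ?_
  rw [LSeries.norm_term_eq]
  rcases eq_or_ne n 0 with rfl | hn
  · simp
  · rw [if_neg hn, Complex.norm_real, Real.norm_eq_abs]

/-- On `Re s > 1`: the Mellin transform of `f(t) = ∑ (Λ(n) − 1) e^{-nt}` is
`Γ(s)(−ζ'/ζ(s) − ζ(s))`. [folklore] -/
theorem mellin_laplaceSeries_vonMangoldt_sub_zeta {s : ℂ} (hs : 1 < s.re) :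
    mellin (fun t ↦ ((laplaceSeries (fun n ↦ Λ n - (ζ n : ℝ)) t : ℝ) : ℂ)) s =
      Complex.Gamma s * (-deriv riemannZeta s / riemannZeta s - riemannZeta s) := by
  have hs0 : 0 < s.re := by linarith
  rw [mellin_laplaceSeries vonMangoldt_sub_zeta_zero hs0
    (summable_abs_vonMangoldt_sub_zeta_div_rpow hs)]
  congr 1
  have hΛ := ArithmeticFunction.LSeriesSummable_vonMangoldt hs
  have hζ := ArithmeticFunction.LSeriesSummable_zeta_iff.mpr hs
  have hfun : (fun n ↦ ((Λ n - (ζ n : ℝ) : ℝ) : ℂ)) = ↗Λ - ↗ζ := by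
    funext n
    simp only [Pi.sub_apply, Complex.ofReal_sub, Complex.ofReal_natCast]
  rw [hfun, LSeries_sub hΛ hζ, ArithmeticFunction.LSeries_vonMangoldt_eq_deriv_riemannZeta_div hs,
    ArithmeticFunction.LSeries_zeta_eq_riemannZeta hs]

/-- `∑_{n ≥ 1} e^{-nt} = (1 − e^{-t})⁻¹ − 1` for `t > 0` (the Laplace series of `ζ`). [folklore] -/
theorem laplaceSeries_zeta {t : ℝ} (ht : 0 < t) :
    laplaceSeries (fun n ↦ ((ζ n : ℕ) : ℝ)) t = (1 - Real.exp (-t))⁻¹ - 1 := by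
  rw [← laplaceSeries_one ht, laplaceSeries_def, laplaceSeries_def]
  have h1 : Summable fun n : ℕ ↦ (1 : ℝ) * Real.exp (-t * n) :=
    (summable_abs_mul_exp_of_le (B := 1) (k := 0) (fun n ↦ by simp) ht).of_norm
  have hδ : Summable fun n : ℕ ↦ (if n = 0 then (1 : ℝ) else 0) * Real.exp (-t * n) :=
    (summable_abs_mul_exp_of_le (B := 1) (k := 0) (fun n ↦ by split_ifs <;> simp) ht).of_norm
  have hpt : ∀ n : ℕ, ((ζ n : ℕ) : ℝ) * Real.exp (-t * n) =
      1 * Real.exp (-t * n) - (if n = 0 then (1 : ℝ) else 0) * Real.exp (-t * n) := by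
    intro n
    rcases eq_or_ne n 0 with rfl | hn
    · simp
    · simp [ArithmeticFunction.zeta_apply_ne hn, hn]
  simp_rw [hpt]
  rw [h1.tsum_sub hδ]
  congr 1
  rw [tsum_eq_single 0 fun n hn ↦ by simp [hn]]
  simp

/-- `|∑_{n ≥ 1} e^{-nt} − 1/t| ≤ 1` for `0 < t ≤ 1` (`1/(eᵗ − 1) = 1/t + O(1)`). [folklore] -/
theorem abs_laplaceSeries_zeta_sub_inv_le {t : ℝ} (ht : 0 < t) (ht1 : t ≤ 1) :
    |laplaceSeries (fun n ↦ ((ζ n : ℕ) : ℝ)) t - 1 / t| ≤ 1 := by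
  rw [laplaceSeries_zeta ht]
  obtain ⟨hq1, hq2, hq3⟩ := one_sub_exp_neg_bounds ht ht1
  set q := 1 - Real.exp (-t)
  have hq0 : 0 < q := by linarith
  -- `0 ≤ 1/q − 1/t ≤ 2`
  have h1 : q⁻¹ - 1 / t = (t - q) / (q * t) := by field_simp
  have h2 : 0 ≤ q⁻¹ - 1 / t := by rw [h1]; exact div_nonneg (by linarith) (by positivity)
  have h3 : q⁻¹ - 1 / t ≤ 2 := by
    rw [h1, div_le_iff₀ (by positivity)]; nlinarith
  rw [abs_le]
  constructor <;> linarith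

/-! ### The Landau-type converse for the Laplace series of `Λ` -/

/-- **Landau-type converse for `∑ Λ(n) e^{-nt}`.** If `∑ Λ(n) e^{-nt} − 1/t = O(t^{-σ₀})` as
`t → 0⁺` for some `σ₀ > 0`, then `ζ(s) ≠ 0` for `σ₀ < Re s < 1`. The argument is that of
Montgomery–Vaughan §15.1 (the tree's `VonKochConverse.quasiRiemannHypothesis_of_isBigO`), with
the Mellin transform `M(s) = ∫₀^∞ (∑ (Λ(n) − 1)e^{-nt}) t^{s-1} dt = Γ(s)(−ζ'/ζ(s) − ζ(s))`
(`Re s > 1`), holomorphic on `Re s > σ₀`, in place of `s ∫ (ψ(x) − ⌊x⌋) x^{-s-1} dx`.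
[cite: MontgomeryVaughan2007, §15.1 (argument, applied to the Laplace transform)] -/
theorem quasiRiemannHypothesis_of_laplaceSeries_vonMangoldt_isBigO {σ₀ : ℝ} (hσ₀ : 0 < σ₀)
    (hF : (fun t ↦ laplaceSeries (fun n ↦ Λ n) t - 1 / t) =O[𝓝[>] 0] fun t ↦ t ^ (-σ₀)) :
    QuasiRiemannHypothesis σ₀ := by
  rcases le_or_gt 1 σ₀ with hσ1 | hσ1
  · exact quasiRiemannHypothesis_one.mono hσ1
  set b : ℕ → ℝ := fun n ↦ Λ n - ((ζ n : ℕ) : ℝ) with hb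
  set M : ℂ → ℂ := mellin fun t ↦ ((laplaceSeries b t : ℝ) : ℂ) with hM
  -- `f = F − G₁` is `O(t^{-σ₀})` at `0⁺`
  have hfO : (fun t ↦ ((laplaceSeries b t : ℝ) : ℂ)) =O[𝓝[>] 0] fun t ↦ t ^ (-σ₀) := by
    have hreal : (fun t ↦ laplaceSeries b t) =O[𝓝[>] 0] fun t ↦ t ^ (-σ₀) := by
      have hrest : (fun t ↦ 1 / t - laplaceSeries (fun n ↦ ((ζ n : ℕ) : ℝ)) t) =O[𝓝[>] 0]
          fun t ↦ t ^ (-σ₀) := by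
        refine IsBigO.of_bound 1 ?_
        filter_upwards [Ioo_mem_nhdsGT one_pos] with t ht
        rw [Real.norm_eq_abs, Real.norm_eq_abs, abs_sub_comm, one_mul,
          abs_of_pos (Real.rpow_pos_of_pos ht.1 _)]
        exact (abs_laplaceSeries_zeta_sub_inv_le ht.1 ht.2.le).trans
          (Real.one_le_rpow_of_pos_of_le_one_of_nonpos ht.1 ht.2.le (by linarith))
      refine (hF.add hrest).congr' ?_ EventuallyEq.rfl
      filter_upwards [Ioo_mem_nhdsGT one_pos] with t ht
      have hΛs : Summable fun n : ℕ ↦ Λ n * Real.exp (-t * n) :=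
        (summable_abs_mul_exp_of_le (abs_le_one_mul_pow_one fun n ↦ by
          rw [abs_of_nonneg (vonMangoldt_nonneg_le n).1]; exact (vonMangoldt_nonneg_le n).2)
          ht.1).of_norm
      have hζs : Summable fun n : ℕ ↦ ((ζ n : ℕ) : ℝ) * Real.exp (-t * n) :=
        (summable_abs_mul_exp_of_le (abs_le_one_mul_pow_one abs_zeta_le) ht.1).of_norm
      simp only [hb, laplaceSeries_def, sub_mul]
      rw [hΛs.tsum_sub hζs]
      ring
    have h1 := hreal.norm_left
    exact (h1.congr_left fun t ↦ (Complex.norm_real _).symm).of_norm_left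
  -- `M` is holomorphic on `Re s > σ₀`
  have hMd : ∀ s : ℂ, σ₀ < s.re → DifferentiableAt ℂ M s := fun s hs ↦
    differentiableAt_mellin_laplaceSeries vonMangoldt_sub_zeta_zero abs_vonMangoldt_sub_zeta_le
      hfO hs
  -- `M = Γ (−ζ'/ζ − ζ)` on `Re s > 1`
  have hMid : ∀ s : ℂ, 1 < s.re →
      M s = Complex.Gamma s * (-deriv riemannZeta s / riemannZeta s - riemannZeta s) :=
    fun s hs ↦ mellin_laplaceSeries_vonMangoldt_sub_zeta hs
  -- the identity-theorem argument of Montgomery–Vaughan §15.1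
  intro s₀ hζ h1 h2
  set U := VonKochConverse.slitHalfPlane σ₀ with hU
  set Φ : ℂ → ℂ := fun s ↦ deriv riemannZeta s * Complex.Gamma s +
    (M s + Complex.Gamma s * riemannZeta s) * riemannZeta s with hΦ
  have hU1 : ∀ s ∈ U, s ≠ 1 := fun s hs h ↦ VonKochConverse.one_notMem_slitHalfPlane σ₀ (h ▸ hs)
  have hUre : ∀ s ∈ U, 0 < s.re := fun s hs ↦ hσ₀.trans hs.1
  have hΓd : ∀ s ∈ U, DifferentiableAt ℂ Complex.Gamma s := by
    intro s hs
    refine Complex.differentiableAt_Gamma s fun m hm ↦ ?_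
    have := hUre s hs
    rw [hm] at this
    simp at this
    linarith [(m.cast_nonneg : (0 : ℝ) ≤ m)]
  have hΓ0 : ∀ s ∈ U, Complex.Gamma s ≠ 0 := fun s hs ↦ Complex.Gamma_ne_zero_of_re_pos (hUre s hs)
  have hΦan : AnalyticOnNhd ℂ Φ U := by
    refine DifferentiableOn.analyticOnNhd (fun s hs ↦ ?_) (VonKochConverse.isOpen_slitHalfPlane σ₀)
    have hζd : DifferentiableAt ℂ riemannZeta s := differentiableAt_riemannZeta (hU1 s hs)
    have hdζ : DifferentiableAt ℂ (deriv riemannZeta) s :=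
      (analyticOn_riemannZeta s (hU1 s hs)).deriv.differentiableAt
    have hMs := hMd s hs.1
    have hΓ := hΓd s hs
    have : DifferentiableAt ℂ Φ s := by
      simp only [hΦ]
      fun_prop (disch := assumption)
    exact this.differentiableWithinAt
  have hΦ0 : Φ =ᶠ[𝓝 (2 + I)] 0 := by
    have hopen : IsOpen {s : ℂ | 1 < s.re} := isOpen_lt continuous_const continuous_re
    filter_upwards [hopen.mem_nhds (by simp : (2 + I : ℂ) ∈ {s : ℂ | 1 < s.re})] with s hs
    have hs : 1 < s.re := hs
    have hne := riemannZeta_ne_zero_of_one_lt_re hs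
    have hid := hMid s hs
    simp only [hΦ, Pi.zero_apply, hid]
    field_simp
    ring
  have h2I : (2 + I : ℂ) ∈ U := ⟨by simp; linarith, fun h ↦ by simp at h⟩
  have hΦU : EqOn Φ 0 U :=
    hΦan.eqOn_zero_of_preconnected_of_eventuallyEq_zero
      (VonKochConverse.isPreconnected_slitHalfPlane hσ1) h2I hΦ0
  have hs₀U : s₀ ∈ U := ⟨h1, fun _ ↦ h2⟩
  have hloc : ∀ᶠ s in 𝓝 s₀, deriv riemannZeta s =
      (-(M s + Complex.Gamma s * riemannZeta s) / Complex.Gamma s) * riemannZeta s := by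
    filter_upwards [(VonKochConverse.isOpen_slitHalfPlane σ₀).mem_nhds hs₀U] with s hs
    have h0 := hΦU hs
    simp only [hΦ, Pi.zero_apply] at h0
    have hΓs := hΓ0 s hs
    field_simp
    linear_combination h0
  have hcont : ContinuousAt
      (fun s ↦ -(M s + Complex.Gamma s * riemannZeta s) / Complex.Gamma s) s₀ := by
    have hMs := hMd s₀ hs₀U.1
    have hΓ := hΓd s₀ hs₀U
    have hΓs := hΓ0 s₀ hs₀U
    have hζd : DifferentiableAt ℂ riemannZeta s₀ := differentiableAt_riemannZeta (hU1 s₀ hs₀U)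
    have : DifferentiableAt ℂ
        (fun s ↦ -(M s + Complex.Gamma s * riemannZeta s) / Complex.Gamma s) s₀ := by
      fun_prop (disch := assumption)
    exact this.continuousAt
  have hzero := VonKochConverse.eventuallyEq_zero_of_deriv_eq_mul
    (analyticOn_riemannZeta s₀ (hU1 s₀ hs₀U)) hcont hloc hζ
  have hall := analyticOn_riemannZeta.eqOn_zero_of_preconnected_of_eventuallyEq_zero
    (isConnected_compl_singleton_of_one_lt_rank (by simp) 1).isPreconnected (hU1 s₀ hs₀U) hzero
  have h2 : riemannZeta 2 = 0 := hall (by norm_num)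
  exact riemannZeta_ne_zero_of_one_lt_re (by norm_num) h2

/-- **Bhowmik–Ruzsa, Thm. 2.1 (sharp form).** If the summatory function of the Goldbach
function `G_Λ(m) = ∑_{i+j=m} Λ(i)Λ(j)` satisfies `|∑_{m ≤ n} G_Λ(m) − n²/2| ≤ C (n+1)^α` for all
`n`, with `1 < α`, then `ζ(s) ≠ 0` for `α − 1 < Re s < 1`
(`Literature.NumberTheory.LFunctions.QuasiRiemannHypothesis (α − 1)`). Bhowmik–Ruzsa state
"`S(x) = x²/2 + O(x^{2−δ})` implies `Re ρ < 1 − δ'` for some `δ' > 0`" (with `δ' = δ/6`); the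
present route (their power-series step, then Mellin continuation instead of the Tauberian return
to `ψ`) gives `δ' = δ`, the value they attribute to "the methods of [1,2,4]" (Remark 1). Used with
`α = 3/2 + ε` for Granville's Thm. 1A. [cite: BhowmikRuzsa2018, Thm. 2.1 and Remark 1] -/
theorem quasiRiemannHypothesis_of_selfConvSum_vonMangoldt {C α : ℝ} (hα : 1 < α)
    (hS : ∀ n : ℕ, |selfConvSum (fun n ↦ Λ n) n - (n : ℝ) ^ 2 / 2| ≤ C * ((n : ℝ) + 1) ^ α) :
    QuasiRiemannHypothesis (α - 1) := by
  obtain ⟨C', hC'⟩ := exists_abs_laplaceSeries_sub_inv_le (fun n ↦ (vonMangoldt_nonneg_le n).1)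
    (fun n ↦ (vonMangoldt_nonneg_le n).2) hα.le hS
  refine quasiRiemannHypothesis_of_laplaceSeries_vonMangoldt_isBigO (by linarith) ?_
  refine IsBigO.of_bound C' ?_
  filter_upwards [Ioo_mem_nhdsGT one_pos] with t ht
  rw [Real.norm_eq_abs, Real.norm_eq_abs, abs_of_pos (Real.rpow_pos_of_pos ht.1 _),
    show -(α - 1) = 1 - α by ring]
  exact hC' t ht.1 ht.2.le

end Literature.NumberTheory.LFunctions

end
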